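import Summits.SmoothPoincare4.SmoothPoincare4.Theorems.ConvexBisectionAcyclicBisectionExistsPicardLefschetzPieces
import Literature.AlgebraicTopology.SingularHomology.ExcisionMayerVietoris
import Literature.AlgebraicTopology.FundamentalGroup.PathSegment
import Mathlib.Analysis.Convex.Contractible
import HarnessLib

/-!
# Picard–Lefschetz on shadows, III: the variation of a page twist, piece by piece
(wave 2, brick N1a = (M3c) of stub `stub_modelsOnFibred_of_reach` = NF4
`Literature.Topology.FourManifolds.LefschetzBase.modelsOnFibred_of_reach`, line `modp-braid-orbits`,
crux `ConvexBisection.AcyclicBisectionExists`, item stmt-SmoothPoincare4-10508; registered sub-goal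
`helper_continuous_phaseLoop`; file 3 of the Picard–Lefschetz bricks, sequel of
`…PicardLefschetzPieces.lean`)

The homological Picard–Lefschetz formula for the page twist `τ` (`τ (φ (u, r)) = φ (u ± β r, r)` on
the annulus chart `φ`, `τ = id` off the open annulus `A`) is proved in file 4 by cutting the
unit-period loop `L` of a page curve `K` into small pieces `L[t₁, t₂]`, each inside `A` or off the
closed collar `B^c = φ(ℝ × [−1/2, 1/2])`, and summing the classes of the PIECE CYCLES
`z[t₁, t₂] = ⟨τ ∘ L[t₁, t₂]⟩ − ⟨L[t₁, t₂]⟩ − κ_{L t₂} + κ_{L t₁}` (`κ` the correction chains of file 2).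
This file computes the pieces:

* §1 `isCompact_collar`; **`continuous_phaseLoop`** (`helper_continuous_phaseLoop`) — the phase
  loop `exp (2πi χ(height ∘ K))` of file 2 is continuous (inside `A` through a lift of `K`,
  `exists_chart_lift`; off the collar it is `1`); its logarithm increases by
  `2πi (χ(height (K t₂)) − χ(height (K t₁)))` along a piece inside `A` (`log_sub_log_of_annulus`)
  and by `0` along a piece off the collar (`log_sub_log_of_not_mem_collar`);
* §2 **`exists_d_eq_piece_of_annulus`** — a piece inside `A` has NULL-HOMOLOGOUS piece cycle:
  lifted through `φ` (`exists_chart_lift`) the four paths close up to a `1`-cycle of the plane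
  `ℝ²`, a boundary since `H₁(ℝ²; ℤ) = 0` (`isZero_singularHomology_of_contractibleSpace`), and
  `φ♯` of that boundary is the piece cycle (`corrChain_eq_of_lift`);
  `ofPath_segment_map_of_not_mem_collar` — along a piece off the collar `τ ∘ L = L`;
* §3 `exists_d_eq_split`, `exists_d_eq_sub_sum_segments` — subdividing a path into `N` segments
  changes its singular chain by a boundary (`segment_trans_segment`, `d_homotopyChain`,
  `d_single_ofTrans`).

Everything is proved; no named facts, no `sorry`.  References: B. Farb, D. Margalit, *A primer on
mapping class groups* (2012), Prop. 6.3 [FarbMargalit2012]; A. Hatcher, *Algebraic Topology* (2002),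
§2.1 and Thm. 2A.1 [HatcherAT2002].
-/

noncomputable section

set_option linter.dupNamespace false

open scoped Manifold ContDiff Topology Real
open Set Function Metric Filter
open Literature.Topology.FourManifolds Literature.Topology.FourManifolds.LefschetzBase
  Literature.AlgebraicTopology.SingularHomology Literature.AlgebraicTopology.FundamentalGroup.PathSegment

namespace Summit.SmoothPoincare4.SmoothPoincare4.Theorems.AcyclicBisectionExists.ModpBraidOrbits

open SingularSimplex singularChainComplex

variable {g : ℕ} {c : ℂ} {φ : ℝ × ℝ → Base g} {τ : Base g → Base g} {s : Bool} {β : ℝ → ℝ}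
  {K : sphere (0 : EuclideanSpace ℝ (Fin 2)) 1 → Base g}

/-! ## §1 The collar, continuity of the phase loop and its logarithmic increments -/

/-- **The closed collar `φ(ℝ × [−1/2, 1/2])` is compact** (the image of `[0, 1] × [−1/2, 1/2]` by
periodicity). [folklore] -/
theorem isCompact_collar (hφc : Continuous φ) (hφ1 : ∀ u r, φ (u + 1, r) = φ (u, r)) :
    IsCompact (φ '' (univ ×ˢ Icc (-(1 / 2) : ℝ) (1 / 2))) := by
  have e : φ '' (univ ×ˢ Icc (-(1 / 2) : ℝ) (1 / 2)) = φ '' (Icc (0 : ℝ) 1 ×ˢ Icc (-(1 / 2) : ℝ) (1 / 2)) := by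
    refine Subset.antisymm ?_ (image_mono (prod_mono (subset_univ _) Subset.rfl))
    rintro _ ⟨p, ⟨-, hp⟩, rfl⟩
    exact ⟨(Int.fract p.1, p.2), ⟨⟨Int.fract_nonneg _, (Int.fract_lt_one _).le⟩, hp⟩,
      chart_fract hφ1 p⟩
  rw [e]
  exact (isCompact_Icc.prod isCompact_Icc).image hφc

/-- The height along a lift is the lifted transverse coordinate. [folklore] -/
theorem height_of_lift (hφ1 : ∀ u r, φ (u + 1, r) = φ (u, r))
    (hφi : InjOn φ (Ico (0 : ℝ) 1 ×ˢ Ioo (-1 : ℝ) 1)) {u₀ r₀ : ℝ} (hr₀ : r₀ ∈ Ioo (-1 : ℝ) 1) :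
    height φ (φ (u₀, r₀)) = r₀ :=
  (prelift_apply hφ1 hφi (p := (u₀, r₀)) hr₀).1

/-- **Inside the annulus the logarithm of the phase loop increases by `2πi (χ(h₂) − χ(h₁))`**,
`hⱼ = height (K (e^{2πitⱼ}))`. [folklore] -/
theorem log_sub_log_of_annulus (hc : ‖c‖ = 1) (hφc : Continuous φ)
    (hφ1 : ∀ u r, φ (u + 1, r) = φ (u, r)) (hφp : ∀ p, φ p ∈ page g c)
    (hφi : InjOn φ (Ico (0 : ℝ) 1 ×ˢ Ioo (-1 : ℝ) 1)) (hK : Continuous K) {t₁ t₂ : ℝ}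
    (h12 : t₁ ≤ t₂) (hA : ∀ t ∈ Icc t₁ t₂, K (circlePt t) ∈ φ '' (univ ×ˢ Ioo (-1 : ℝ) 1))
    {l : ℝ → ℂ} (hl : ContinuousOn l (Icc t₁ t₂))
    (hle : ∀ t ∈ Icc t₁ t₂, Complex.exp (l t) = phaseLoop φ K t) :
    l t₂ - l t₁ = ((2 * π * (clampStep (height φ (K (circlePt t₂))) -
      clampStep (height φ (K (circlePt t₁)))) : ℝ) : ℂ) * Complex.I := by
  have hL : Continuous fun t : ℝ => K (circlePt t) := hK.comp continuous_circlePt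
  obtain ⟨u, r, -, hr, hur⟩ := exists_chart_lift hc hφc hφ1 hφp hφi hL.continuousOn hA
  have hh : ∀ t ∈ Icc t₁ t₂, height φ (K (circlePt t)) = r t := fun t ht => by
    rw [← (hur t ht).2]; exact height_of_lift hφ1 hφi (hur t ht).1
  have hm : ContinuousOn (fun t => ((2 * π * clampStep (r t) : ℝ) : ℂ) * Complex.I) (Icc t₁ t₂) :=
    (Complex.continuous_ofReal.comp_continuousOn
      (continuousOn_const.mul (continuous_clampStep.comp_continuousOn hr))).mul continuousOn_const
  obtain ⟨n, hn⟩ := Literature.Topology.PlaneTopology.exists_int_eq_add_of_exp_eq isPreconnected_Icc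
    hl hm (fun t ht => by rw [hle t ht, phaseLoop, hh t ht])
  rw [hn t₂ (right_mem_Icc.2 h12), hn t₁ (left_mem_Icc.2 h12), hh t₂ (right_mem_Icc.2 h12),
    hh t₁ (left_mem_Icc.2 h12)]
  push_cast
  ring

/-- **Off the collar the logarithm of the phase loop does not move.** [folklore] -/
theorem log_sub_log_of_not_mem_collar {t₁ t₂ : ℝ} (h12 : t₁ ≤ t₂)
    (hB : ∀ t ∈ Icc t₁ t₂, K (circlePt t) ∉ φ '' (univ ×ˢ Icc (-(1 / 2) : ℝ) (1 / 2)))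
    {l : ℝ → ℂ} (hl : ContinuousOn l (Icc t₁ t₂))
    (hle : ∀ t ∈ Icc t₁ t₂, Complex.exp (l t) = phaseLoop φ K t) : l t₂ - l t₁ = 0 := by
  obtain ⟨n, hn⟩ := Literature.Topology.PlaneTopology.exists_int_eq_add_of_exp_eq isPreconnected_Icc hl
    (m := fun _ => (0 : ℂ)) continuousOn_const
    (fun t ht => by rw [hle t ht, phaseLoop_eq_one_of_not_mem_collar (hB t ht), Complex.exp_zero])
  rw [hn t₂ (right_mem_Icc.2 h12), hn t₁ (left_mem_Icc.2 h12), sub_self]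

/-- **The phase loop of a page curve is continuous.** [folklore] -/
theorem continuous_phaseLoop (hc : ‖c‖ = 1) (hφc : Continuous φ)
    (hφ1 : ∀ u r, φ (u + 1, r) = φ (u, r)) (hφp : ∀ p, φ p ∈ page g c)
    (hφi : InjOn φ (Ico (0 : ℝ) 1 ×ˢ Ioo (-1 : ℝ) 1)) (hK : Continuous K)
    (hKc : ∀ θ, K θ ∈ page g c) : Continuous (phaseLoop φ K) := by
  have hL : Continuous fun t : ℝ => K (circlePt t) := hK.comp continuous_circlePt
  refine continuous_iff_continuousAt.2 fun t₀ => ?_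
  by_cases hA0 : K (circlePt t₀) ∈ φ '' (univ ×ˢ Ioo (-1 : ℝ) 1)
  · have hU : IsOpen ((fun t : ℝ => K (circlePt t)) ⁻¹' (φ '' (univ ×ˢ Ioo (-1 : ℝ) 1))) :=
      isOpen_preimage_annulus hc hφc hφ1 hφp hφi hL fun t => hKc _
    obtain ⟨ε, hε, hball⟩ := Metric.isOpen_iff.1 hU t₀ hA0
    have hI : ∀ t ∈ Icc (t₀ - ε / 2) (t₀ + ε / 2), K (circlePt t) ∈ φ '' (univ ×ˢ Ioo (-1 : ℝ) 1) :=
      fun t ht => hball (by rw [mem_ball, Real.dist_eq, abs_lt]; constructor <;> linarith [ht.1, ht.2])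
    obtain ⟨u, r, -, hr, hur⟩ := exists_chart_lift hc hφc hφ1 hφp hφi hL.continuousOn hI
    have hon : ContinuousOn (phaseLoop φ K) (Icc (t₀ - ε / 2) (t₀ + ε / 2)) := by
      refine ContinuousOn.congr (f := fun t => Complex.exp (((2 * π * clampStep (r t) : ℝ) : ℂ) *
        Complex.I)) ?_ fun t ht => ?_
      · exact Complex.continuous_exp.comp_continuousOn ((Complex.continuous_ofReal.comp_continuousOn
          (continuousOn_const.mul (continuous_clampStep.comp_continuousOn hr))).mul
            continuousOn_const)
      · rw [phaseLoop, ← (hur t ht).2, height_of_lift hφ1 hφi (hur t ht).1]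
    exact hon.continuousAt (Icc_mem_nhds (by linarith) (by linarith))
  · have hB0 : K (circlePt t₀) ∉ φ '' (univ ×ˢ Icc (-(1 / 2) : ℝ) (1 / 2)) := fun h =>
      hA0 (image_mono (prod_mono Subset.rfl (Icc_subset_Ioo (by norm_num) (by norm_num))) h)
    have hV : IsOpen ((fun t : ℝ => K (circlePt t)) ⁻¹' (φ '' (univ ×ˢ Icc (-(1 / 2) : ℝ) (1 / 2)))ᶜ) :=
      ((isCompact_collar hφc hφ1).isClosed.preimage hL).isOpen_compl
    refine (continuousAt_const (y := (1 : ℂ))).congr ?_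
    filter_upwards [hV.mem_nhds hB0] with t ht
    exact (phaseLoop_eq_one_of_not_mem_collar ht).symm

/-! ## §2 The piece cycles: null-homologous inside the annulus, reduced off the collar -/

/-- The signed shear profile is continuous. [folklore] -/
theorem continuous_twistShift (hβc : Continuous β) : Continuous (twistShift s β) := by
  have e : twistShift s β = fun r => if s then β r else -β r := rfl
  rw [e]
  cases s
  · simp only [Bool.false_eq_true, if_false]
    exact hβc.neg
  · simp only [if_true]
    exact hβc

/-- **The correction chain at `φ (u, r)` may be computed from the preimage `(u, r)` itself.**
[folklore] -/
theorem corrChain_eq_of_lift (hφc : Continuous φ) (hφ1 : ∀ u r, φ (u + 1, r) = φ (u, r))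
    (hφi : InjOn φ (Ico (0 : ℝ) 1 ×ˢ Ioo (-1 : ℝ) 1)) (s : Bool) (β : ℝ → ℝ) {u₀ r₀ : ℝ}
    (hr₀ : r₀ ∈ Ioo (-1 : ℝ) 1) :
    corrChain hφc s β (φ (u₀, r₀)) = single (R := ℤ) (ofPath (corePath hφc s β (u₀, r₀))) 1 := by
  classical
  have hA : φ (u₀, r₀) ∈ φ '' (univ ×ˢ Ioo (-1 : ℝ) 1) := ⟨(u₀, r₀), ⟨trivial, hr₀⟩, rfl⟩
  rw [corrChain, if_pos hA]
  obtain ⟨h2, n, hn⟩ := prelift_apply hφ1 hφi (p := (u₀, r₀)) hr₀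
  congr 1
  refine ofPath_congr _ _ fun t => ?_
  show φ ((prelift φ (φ (u₀, r₀))).1 + (t : ℝ) * twistShift s β (prelift φ (φ (u₀, r₀))).2,
      (prelift φ (φ (u₀, r₀))).2) = φ (u₀ + (t : ℝ) * twistShift s β r₀, r₀)
  rw [h2, hn, show u₀ + (n : ℝ) + (t : ℝ) * twistShift s β r₀ =
    u₀ + (t : ℝ) * twistShift s β r₀ + n by ring, chart_periodic_int hφ1]

/-- **A piece inside the annulus has null-homologous piece cycle**: lifted through the chart, the
four paths `κ₁`, `τ ∘ L[t₁, t₂]`, `κ₂⁻¹`, `L[t₁, t₂]⁻¹` close up to a `1`-cycle of the plane, which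
bounds (`H₁(ℝ²) = 0`); push the bounding `2`-chain forward by `φ`. [cite: FarbMargalit2012, Prop. 6.3] -/
theorem exists_d_eq_piece_of_annulus (hc : ‖c‖ = 1) (hφc : Continuous φ)
    (hφ1 : ∀ u r, φ (u + 1, r) = φ (u, r)) (hφp : ∀ p, φ p ∈ page g c)
    (hφi : InjOn φ (Ico (0 : ℝ) 1 ×ˢ Ioo (-1 : ℝ) 1)) (hβc : Continuous β) (hτ : Continuous τ)
    (hτon : ∀ u r, r ∈ Ioo (-1 : ℝ) 1 → τ (φ (u, r)) = φ (u + (if s then β r else -β r), r))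
    {x y : Base g} (L : Path x y) {t₁ t₂ : ℝ} (h12 : t₁ ≤ t₂)
    (hA : ∀ t ∈ Icc t₁ t₂, L.extend t ∈ φ '' (univ ×ˢ Ioo (-1 : ℝ) 1)) :
    ∃ w : (singularChainComplex ℤ ℤ (Base g)).X 2, (singularChainComplex ℤ ℤ (Base g)).d 2 1 w =
      single (R := ℤ) (ofPath (segment (L.map hτ) t₁ t₂)) 1 -
        single (R := ℤ) (ofPath (segment L t₁ t₂)) 1 -
        corrChain hφc s β (L.extend t₂) + corrChain hφc s β (L.extend t₁) := by
  obtain ⟨u, r, hu, hr, hur⟩ := exists_chart_lift hc hφc hφ1 hφp hφi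
    L.continuous_extend.continuousOn hA
  -- the affine parameter of the segment
  let aff : unitInterval → ℝ := fun θ => t₁ + (t₂ - t₁) * θ
  have haffc : Continuous aff := by fun_prop
  have haffI : ∀ θ, aff θ ∈ Icc t₁ t₂ := fun θ =>
    ⟨le_add_of_nonneg_right (mul_nonneg (sub_nonneg.2 h12) θ.2.1),
      by have := mul_le_of_le_one_right (sub_nonneg.2 h12) θ.2.2; dsimp [aff]; linarith⟩
  have haff0 : aff 0 = t₁ := by simp [aff]
  have haff1 : aff 1 = t₂ := by simp [aff]
  have hu' : Continuous fun θ : unitInterval => u (aff θ) := hu.comp_continuous haffc haffI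
  have hr' : Continuous fun θ : unitInterval => r (aff θ) := hr.comp_continuous haffc haffI
  have hsh : Continuous (twistShift s β) := continuous_twistShift hβc
  -- the four paths of the plane
  let pL : Path (u t₁, r t₁) (u t₂, r t₂) :=
    { toFun := fun θ => (u (aff θ), r (aff θ))
      continuous_toFun := hu'.prodMk hr'
      source' := by simp only [haff0]
      target' := by simp only [haff1] }
  let pT : Path (u t₁ + twistShift s β (r t₁), r t₁) (u t₂ + twistShift s β (r t₂), r t₂) :=
    { toFun := fun θ => (u (aff θ) + twistShift s β (r (aff θ)), r (aff θ))
      continuous_toFun := (hu'.add (hsh.comp hr')).prodMk hr'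
      source' := by simp only [haff0]
      target' := by simp only [haff1] }
  let κ₁ : Path (u t₁, r t₁) (u t₁ + twistShift s β (r t₁), r t₁) :=
    { toFun := fun θ => (u t₁ + (θ : ℝ) * twistShift s β (r t₁), r t₁)
      continuous_toFun := by fun_prop
      source' := by simp
      target' := by simp }
  let κ₂ : Path (u t₂, r t₂) (u t₂ + twistShift s β (r t₂), r t₂) :=
    { toFun := fun θ => (u t₂ + (θ : ℝ) * twistShift s β (r t₂), r t₂)
      continuous_toFun := by fun_prop
      source' := by simp
      target' := by simp }
  let z : (singularChainComplex ℤ ℤ (ℝ × ℝ)).X 1 :=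
    single (R := ℤ) (ofPath pT) 1 - single (R := ℤ) (ofPath pL) 1 -
      single (R := ℤ) (ofPath κ₂) 1 + single (R := ℤ) (ofPath κ₁) 1
  have hz0 : (singularChainComplex ℤ ℤ (ℝ × ℝ)).d 1 0 z = 0 := by
    simp only [z, map_add, map_sub, d_single_ofPath]
    abel
  have hz : (singularChainComplex ℤ ℤ (ℝ × ℝ)).d 1 ((ComplexShape.down ℕ).next 1) z = 0 := by
    rw [d_next_eq_zero_iff (ChainComplex.next_nat_succ 0)]; exact hz0
  -- `H₁(ℝ²) = 0`: the plane cycle bounds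
  have hcls : homologyCls z hz = 0 := by
    haveI := ModuleCat.subsingleton_of_isZero
      (isZero_singularHomology_of_contractibleSpace ℤ ℤ (X := ℝ × ℝ) one_ne_zero)
    exact Subsingleton.elim _ _
  rw [homologyCls_eq_zero_iff, exists_d_prev_eq_iff (i := 2) (ChainComplex.prev ℕ 1)] at hcls
  obtain ⟨wt, hwt⟩ := hcls
  -- push forward by `φ`
  let Φ : C(ℝ × ℝ, Base g) := ⟨φ, hφc⟩
  refine ⟨(singularChainComplex.map ℤ ℤ Φ).f 2 wt, ?_⟩
  rw [← ModuleCat.comp_apply, (singularChainComplex.map ℤ ℤ Φ).comm 2 1, ModuleCat.comp_apply,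
    hwt]
  simp only [z, map_add, map_sub, map_f_single, ofPath_map]
  -- identify the four pieces
  have e1 : ofPath (pT.map Φ.continuous) = ofPath (segment (L.map hτ) t₁ t₂) := by
    refine ofPath_congr _ _ fun θ => ?_
    show φ (u (aff θ) + twistShift s β (r (aff θ)), r (aff θ)) = τ (L.extend (aff θ))
    rw [← (hur _ (haffI θ)).2, hτon _ _ (hur _ (haffI θ)).1, twistShift]
  have e2 : ofPath (pL.map Φ.continuous) = ofPath (segment L t₁ t₂) := by
    refine ofPath_congr _ _ fun θ => ?_
    show φ (u (aff θ), r (aff θ)) = L.extend (aff θ)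
    exact (hur _ (haffI θ)).2
  have e3 : single (R := ℤ) (ofPath (κ₂.map Φ.continuous)) 1 = corrChain hφc s β (L.extend t₂) := by
    rw [← (hur t₂ (right_mem_Icc.2 h12)).2,
      corrChain_eq_of_lift hφc hφ1 hφi s β (hur t₂ (right_mem_Icc.2 h12)).1]
    congr 1
  have e4 : single (R := ℤ) (ofPath (κ₁.map Φ.continuous)) 1 = corrChain hφc s β (L.extend t₁) := by
    rw [← (hur t₁ (left_mem_Icc.2 h12)).2,
      corrChain_eq_of_lift hφc hφ1 hφi s β (hur t₁ (left_mem_Icc.2 h12)).1]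
    congr 1
  rw [e1, e2, e3, e4]

/-- **Off the collar a piece is not moved**: `τ ∘ L[t₁, t₂]` and `L[t₁, t₂]` have the same singular
simplex. [folklore] -/
theorem ofPath_segment_map_of_not_mem_collar (hφ1 : ∀ u r, φ (u + 1, r) = φ (u, r))
    (hβ0 : ∀ r ≤ -(1 / 2 : ℝ), β r = 0) (hβ1 : ∀ r ≥ (1 / 2 : ℝ), β r = 1) (hτ : Continuous τ)
    (hτon : ∀ u r, r ∈ Ioo (-1 : ℝ) 1 → τ (φ (u, r)) = φ (u + (if s then β r else -β r), r))
    (hτoff : ∀ p ∈ page g c, p ∉ φ '' (univ ×ˢ Ioo (-1 : ℝ) 1) → τ p = p)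
    {x y : Base g} (L : Path x y) (hL : ∀ t, L.extend t ∈ page g c) {t₁ t₂ : ℝ} (h12 : t₁ ≤ t₂)
    (hB : ∀ t ∈ Icc t₁ t₂, L.extend t ∉ φ '' (univ ×ˢ Icc (-(1 / 2) : ℝ) (1 / 2))) :
    ofPath (segment (L.map hτ) t₁ t₂) = ofPath (segment L t₁ t₂) := by
  refine ofPath_congr _ _ fun θ => ?_
  show τ (L.extend (t₁ + (t₂ - t₁) * θ)) = L.extend (t₁ + (t₂ - t₁) * θ)
  have hI : t₁ + (t₂ - t₁) * (θ : ℝ) ∈ Icc t₁ t₂ :=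
    ⟨le_add_of_nonneg_right (mul_nonneg (sub_nonneg.2 h12) θ.2.1),
      by have := mul_le_of_le_one_right (sub_nonneg.2 h12) θ.2.2; linarith⟩
  exact tau_eq_self_of_not_mem_collar hφ1 hβ0 hβ1 hτon hτoff (hL _) (hB _ hI)

/-! ## §3 Subdividing a path changes its chain by a boundary -/

/-- **Splitting**: `⟨γ[a, c]⟩ − ⟨γ[a, b]⟩ − ⟨γ[b, c]⟩` is a boundary. [cite: HatcherAT2002, Thm. 2A.1] -/
theorem exists_d_eq_split {X : Type} [TopologicalSpace X] {x y : X} (γ : Path x y) (a b e : ℝ) :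
    ∃ w : (singularChainComplex ℤ ℤ X).X 2, (singularChainComplex ℤ ℤ X).d 2 1 w =
      single (R := ℤ) (ofPath (segment γ a e)) 1 - single (R := ℤ) (ofPath (segment γ a b)) 1 -
        single (R := ℤ) (ofPath (segment γ b e)) 1 := by
  obtain ⟨F⟩ := segment_trans_segment γ a b e
  refine ⟨-homotopyChain ℤ ℤ (1 : ℤ) F - single (R := ℤ) (ofTrans (segment γ a b) (segment γ b e)) 1, ?_⟩
  rw [map_sub, map_neg, d_homotopyChain, d_single_ofTrans]
  abel

/-- **Subdivision**: for `N ≥ 1`, `⟨γ⟩ − Σ_{i<N} ⟨γ[i/N, (i+1)/N]⟩` is a boundary.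
[cite: HatcherAT2002, Thm. 2A.1] -/
theorem exists_d_eq_sub_sum_segments {X : Type} [TopologicalSpace X] {x y : X} (γ : Path x y)
    {N : ℕ} (hN : N ≠ 0) :
    ∃ w : (singularChainComplex ℤ ℤ X).X 2, (singularChainComplex ℤ ℤ X).d 2 1 w =
      single (R := ℤ) (ofPath γ) 1 - ∑ i ∈ Finset.range N,
        single (R := ℤ) (ofPath (segment γ ((i : ℝ) / N) (((i : ℝ) + 1) / N))) 1 := by
  -- partial statement for the first `k` segments
  have key : ∀ k : ℕ, ∃ w : (singularChainComplex ℤ ℤ X).X 2, (singularChainComplex ℤ ℤ X).d 2 1 w =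
      single (R := ℤ) (ofPath (segment γ 0 ((k : ℝ) / N))) 1 - ∑ i ∈ Finset.range k,
        single (R := ℤ) (ofPath (segment γ ((i : ℝ) / N) (((i : ℝ) + 1) / N))) 1 := by
    intro k
    induction k with
    | zero =>
      refine ⟨single (R := ℤ) (const₂ (γ.extend 0)) 1, ?_⟩
      rw [Finset.sum_range_zero, sub_zero, d_single_const₂, Nat.cast_zero, zero_div]
      congr 1
      exact ofPath_congr _ _ fun t => by rw [segment_apply]; simp
    | succ k ih =>
      rw [Nat.cast_succ]
      obtain ⟨w, hw⟩ := ih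
      obtain ⟨w', hw'⟩ := exists_d_eq_split (X := X) γ 0 ((k : ℝ) / N) (((k : ℝ) + 1) / N)
      refine ⟨w + w', ?_⟩
      rw [map_add, hw, hw', Finset.sum_range_succ]
      abel
  obtain ⟨w, hw⟩ := key N
  refine ⟨w, ?_⟩
  rw [hw, div_self (Nat.cast_ne_zero.2 hN)]
  congr 2
  refine ofPath_congr _ _ fun t => ?_
  rw [segment_apply, zero_add, sub_zero, one_mul, Path.extend_extends']

/-- **Sub-goal `helper_continuous_phaseLoop`** (N1a of NF4, file 3): the phase loop of a page
curve relative to an annulus chart of its page is continuous, in registered form. [folklore] -/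
theorem helper_continuous_phaseLoop : ∀ (g : ℕ) (c : ℂ) (φ : ℝ × ℝ → Literature.Topology.FourManifolds.LefschetzBase.Base g) (K : Metric.sphere (0 : EuclideanSpace ℝ (Fin 2)) 1 → Literature.Topology.FourManifolds.LefschetzBase.Base g), ‖c‖ = 1 → Continuous φ → (∀ u r, φ (u + 1, r) = φ (u, r)) → (∀ p, φ p ∈ Literature.Topology.FourManifolds.LefschetzBase.page g c) → Set.InjOn φ (Set.Ico (0 : ℝ) 1 ×ˢ Set.Ioo (-1 : ℝ) 1) → Continuous K → (∀ θ, K θ ∈ Literature.Topology.FourManifolds.LefschetzBase.page g c) → Continuous (Summit.SmoothPoincare4.SmoothPoincare4.Theorems.AcyclicBisectionExists.ModpBraidOrbits.phaseLoop φ K) :=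
  fun _ _ _ _ hc hφc hφ1 hφp hφi hK hKc => continuous_phaseLoop hc hφc hφ1 hφp hφi hK hKc

end Summit.SmoothPoincare4.SmoothPoincare4.Theorems.AcyclicBisectionExists.ModpBraidOrbits

end
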